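import Mathlib
import Summits.NavierStokesRegularity.NavierStokesRegularity.Theorems.TaoLadderRungTwoBreakOneShiftB8E8W91Defs
import Summits.NavierStokesRegularity.NavierStokesRegularity.Theorems.TaoLadderRungTwoBreakCircuitTableQuadTermLip
import Summits.NavierStokesRegularity.NavierStokesRegularity.Theorems.TaoLadderRungTwoBreakCircuitTableAbsSum
import Summits.NavierStokesRegularity.NavierStokesRegularity.Theorems.TaoLadderRungTwoBreakCircuitTableT4
import Summits.NavierStokesRegularity.NavierStokesRegularity.Theorems.TaoLadderRungTwoBreakOneShiftT4W76Rows
import HarnessLib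

/-!
# The one-shift instance B8 @ ε₀ = 2/25, W = 91: the frame / scalar / ROW arithmetic of
# `exists_surviving_dssWave_of_windowCert_v7s` in the kernel (exact rationals) — helper module of
# `…OneShiftB8E8W91` (cell harvest/h2-tao-ladder, seat p2; rung1/INSTANCE-SHEET-T4-0.1-W76.md (the B8 instance follows the same sheet);
# support for K1(1) = `NoSurvivingDSSOne`, stmt-NavierStokesRegularity-20205)

MODEL lattice only (Tao-type averaged cascade with the comparable circuit table B8, scale ratio `27/25`);
nothing here is a statement about the Navier–Stokes equations; no item is closed.

Contents: `Λ₀ = bigLam (2/25) ∈ [1.2121, 1.2122]` (from `Λ₀² = 1.4693280768`), `Λ₀^90 = 1.4693280768^45`; `|α| ≤ 1` and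
`Σ|α|_i ≤ 2.62` for B8; the values of the closed-form frame functions of module `…OneShiftB8E8W91Defs` on the
wake / top shells and at the two edge shells; and the nine finite rows of `…_v7s` with `q = 13/25` (as in `…T4W76Rows`).
Python exact-rational twin with the same constants: harvest/h2-tao-ladder rung1/num4c/inst_exact_rows.py (row B8E8W91: 92 checks, all OK).
-/

noncomputable section

-- the sub-problem namespace repeats the summit name by design (D-0017)
set_option linter.dupNamespace false

namespace Summit.NavierStokesRegularity.NavierStokesRegularity.Theorems

namespace DSSOneShift

open Set Literature.Analysis.FluidPDE Literature.Analysis.FluidPDE.TaoCascade CertificateGlueOn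
open OneShiftFrame

namespace B8E8W91

/-! ### `Λ₀ = (27/25)^{5/2}` and the table -/

/-- `1.2121 ≤ Λ₀ ≤ 1.2122` (`Λ₀² = 1.08⁵ = 1.4693280768`). [cite: Tao2016AveragedNS, §4 (4.1)] -/
theorem bigLam_e8_bounds : (12121 / 10000 : ℝ) ≤ bigLam (2 / 25) ∧ bigLam (2 / 25) ≤ 12122 / 10000 := by
  have h2 : bigLam (2 / 25 : ℝ) ^ 2 = 14693280768 / 10000000000 := by rw [bigLam_sq (by norm_num)]; norm_num
  have hpos : 0 < bigLam (2 / 25 : ℝ) := bigLam_pos (by norm_num)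
  constructor <;> nlinarith

/-- `Λ₀^90 = 1.4693280768^45` (even power: rational; `W = 91` is odd, so `Λ₀^W = Λ₀^90 · Λ₀` is bounded, not evaluated). [cite: Tao2016AveragedNS, §4 (4.1)] -/
theorem bigLam_e8_pow_90 : bigLam (2 / 25 : ℝ) ^ 90 = (14693280768 / 10000000000) ^ 45 := by
  rw [show (90 : ℕ) = 2 * 45 by norm_num, pow_mul, bigLam_sq (by norm_num)]; norm_num

/-- Every structure constant of B8 has modulus `≤ 1`. [cite: Tao2016AveragedNS, §6.1; cell vocabulary (`IsComparableCoeff`), module …CircuitTableT4] -/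
theorem abs_αB8_le_one (i₁ i₂ i₃ : Fin 4) (μ : ℤ × ℤ × ℤ) : |αB8 i₁ i₂ i₃ μ| ≤ 1 := by
  have hT := inTableClass_circuitTable_B8 (ε₀ := 2 / 25) (by norm_num) (by norm_num)
  by_cases hμ : μ ∈ shiftSet
  · exact (hT.2.2 i₁ i₂ i₃ μ hμ).1
  · unfold αB8
    rw [circuitTable_eq_zero_of_not_mem _ _ _ _ _ i₁ i₂ i₃ μ hμ, abs_zero]
    exact zero_le_one

/-- `Σ_{i₁i₂μ}|α_{i₁i₂iμ}| ≤ 2.62` for every mode of B8 at this `Λ₀` (`(2.6196, 0.8353, 0.3731, 1.8598)`). [cite: Tao2016AveragedNS, §4 (4.1); cell vocabulary, module …CircuitTableAbsSum] -/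
theorem tableAbsSum_αB8_le (i : Fin 4) : tableAbsSum αB8 i ≤ S := by
  obtain ⟨-, hΛhi⟩ := bigLam_e8_bounds
  have hpos : 0 < bigLam (2 / 25 : ℝ) := bigLam_pos (by norm_num)
  have hk : |bigLam (2 / 25) * 0.70928| ≤ 8598 / 10000 := by
    rw [abs_of_nonneg (by positivity)]; linarith
  obtain ⟨h0, h1, h2, h3⟩ := tableAbsSum_circuitTable 1 0.61103 0.14881 0.22427 (bigLam (2 / 25) * 0.70928)
  have e1 : |(1 : ℝ)| = 1 := abs_one
  have e2 : |(0.61103 : ℝ)| = 0.61103 := abs_of_pos (by norm_num)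
  have e3 : |(0.14881 : ℝ)| = 0.14881 := abs_of_pos (by norm_num)
  have e4 : |(0.22427 : ℝ)| = 0.22427 := abs_of_pos (by norm_num)
  rw [e1, e2, e3, e4] at *
  unfold S
  fin_cases i <;> [exact h0.le.trans (by linarith); exact h1.le.trans (by norm_num);
    exact h2.le.trans (by norm_num); exact h3.le.trans (by linarith)]

/-- `0 ≤ Σ|α|_i`. [folklore] -/
theorem tableAbsSum_nonneg (i : Fin 4) : 0 ≤ tableAbsSum αB8 i := by
  unfold tableAbsSum
  exact Finset.sum_nonneg fun _ _ => Finset.sum_nonneg fun _ _ => Finset.sum_nonneg fun _ _ => abs_nonneg _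

/-! ### Values of the frame functions -/


/-- [folklore] -/
theorem AB8_nonneg (k : ℤ) : 0 ≤ AB8 k := by
  unfold AB8 Q βw gHi εR abart; split_ifs <;> positivity

/-- [folklore] -/
theorem RB8_nonneg (k : ℤ) : 0 ≤ RB8 k := by
  have hpos : 0 < bigLam (2 / 25 : ℝ) := bigLam_pos (by norm_num)
  unfold RB8 S Q βw gHi abart; split_ifs <;> positivity

/-- [folklore] -/
theorem vmaxB8_nonneg (k : ℤ) : 0 ≤ vmaxB8 k := by unfold vmaxB8; split_ifs <;> positivity
/-- [folklore] -/
theorem χbB8_nonneg (k : ℤ) : 0 ≤ χbB8 k := by unfold χbB8; split_ifs <;> positivity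
/-- [folklore] -/
theorem χeB8_nonneg (k : ℤ) : 0 ≤ χeB8 k := by unfold χeB8; split_ifs <;> positivity

/-- [folklore] -/
theorem wtB8_wake (n : ℕ) : wtB8 (-(n : ℤ) - 1) = 1 * θw ^ (n + 1) := by
  have e : (-(-(n : ℤ) - 1)).toNat = n + 1 := by omega
  unfold wtB8; rw [if_pos (by omega), e, one_mul]

/-- [folklore] -/
theorem wtB8_top (j : ℕ) : wtB8 ((91 : ℤ) + (j : ℤ)) = ωt * (1 / 2) ^ j := by
  have e : ((91 : ℤ) + (j : ℤ) - 91).toNat = j := by omega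
  unfold wtB8; rw [if_neg (by omega), if_pos (by omega), e]

/-- [folklore] -/
theorem tubeRB8_wake (n : ℕ) : tubeRB8 (-(n : ℤ) - 1) = gHi ^ (n + 1) * (r₀ + κw * ((n : ℝ) + 1)) := by
  have e : (-(-(n : ℤ) - 1)).toNat = n + 1 := by omega
  unfold tubeRB8; rw [if_pos (by omega), e]; push_cast; ring

/-- [folklore] -/
theorem tubeRB8_top (j : ℕ) : tubeRB8 ((91 : ℤ) + (j : ℤ)) = εR * (1 / 2) ^ j := by
  have e : ((91 : ℤ) + (j : ℤ) - 91).toNat = j := by omega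
  unfold tubeRB8; rw [if_neg (by omega), if_pos (by omega), e]

/-- [folklore] -/
theorem tubeCB8_wake (c₀ : Fin 4 → ℝ) (i : Fin 4) (n : ℕ) :
    tubeCB8 c₀ i (-(n : ℤ) - 1) = ghat ^ (n + 1) * c₀ i := by
  have e : (-(-(n : ℤ) - 1)).toNat = n + 1 := by omega
  unfold tubeCB8; rw [if_pos (by omega), e]

/-- [folklore] -/
theorem tubeCB8_top (c₀ : Fin 4 → ℝ) (i : Fin 4) (j : ℕ) : tubeCB8 c₀ i ((91 : ℤ) + (j : ℤ)) = 0 := by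
  unfold tubeCB8; rw [if_neg (by omega)]

/-- [folklore] -/
theorem AB8_wake (n : ℕ) : AB8 (-(n : ℤ) - 1) = Q * βw ^ (n + 1) := by
  have e : (-(-(n : ℤ) - 1)).toNat = n + 1 := by omega
  unfold AB8; rw [if_pos (by omega), e]

/-- [folklore] -/
theorem AB8_top (j : ℕ) : AB8 ((91 : ℤ) + (j : ℤ)) = εR * (1 / 2) ^ j := by
  have e : ((91 : ℤ) + (j : ℤ) - 91).toNat = j := by omega
  unfold AB8; rw [if_neg (by omega), if_pos (by omega), e]

/-- [folklore] -/
theorem RB8_wake (j : ℕ) :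
    RB8 (-(j : ℤ) - 1) = (S * Q ^ 2 * βw ^ 2) * (βw ^ 2 * (bigLam (2 / 25))⁻¹) ^ (j + 1) := by
  have e : (-(-(j : ℤ) - 1)).toNat = j + 1 := by omega
  unfold RB8; rw [if_pos (by omega), e]

/-- [folklore] -/
theorem RB8_top (j : ℕ) : RB8 ((91 : ℤ) + (j : ℤ)) =
    (S * abart ^ 2 * bigLam (2 / 25) ^ (91 : ℕ)) * (bigLam (2 / 25) * (1 / 2) ^ 2) ^ j := by
  have e : ((91 : ℤ) + (j : ℤ) - 91).toNat = j := by omega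
  unfold RB8; rw [if_neg (by omega), if_pos (by omega), e]

/-- The amplitude hulls near the bottom edge are `≤ Q β²`. [folklore] -/
theorem AB8_le_bot (k' : ℤ) (h1 : -1 - 1 ≤ k') (h2 : k' ≤ -1 + 1) : AB8 k' ≤ Q * βw ^ 2 := by
  interval_cases k' <;> norm_num [AB8, Q, βw, gHi, T4W76.toNat_two]

/-- The amplitude hulls near the top edge are `≤ ā_t`. [folklore] -/
theorem AB8_le_top (k' : ℤ) (h1 : (91 : ℤ) - 1 ≤ k') (h2 : k' ≤ (91 : ℤ) + 1) : AB8 k' ≤ abart := by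
  interval_cases k' <;> norm_num [AB8, abart, εR]

variable (bd : BoxData)

/-- [folklore] -/
theorem frame_W : ((frame bd).W : ℤ) = 91 := by show ((91 : ℕ) : ℤ) = 91; norm_num
/-- [folklore] -/
theorem frame_W' : (frame bd).W = 91 := rfl
/-- [folklore] -/
theorem frame_τhi : (B8E8W91.frame bd).τhi = B8E8W91.τc + B8E8W91.rτ := rfl
/-- [folklore] -/
theorem frame_rτ : (B8E8W91.frame bd).rτ = B8E8W91.rτ := rfl
/-- [folklore] -/
theorem frame_wt (k : ℤ) : (frame bd).wt k = wtB8 k := rfl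
/-- [folklore] -/
theorem frame_tubeR (k : ℤ) : (frame bd).tubeR k = tubeRB8 k := rfl
/-- [folklore] -/
theorem frame_tubeC (i : Fin 4) (k : ℤ) : (frame bd).tubeC i k = tubeCB8 (fun i => bd.yc i 0) i k := rfl
/-- [folklore] -/
theorem wtB8_m1 : wtB8 (-1) = θw := by norm_num [wtB8]
/-- [folklore] -/
theorem wtB8_91 : wtB8 91 = ωt := by norm_num [wtB8]
/-- [folklore] -/
theorem τhi_nonneg : (0 : ℝ) ≤ B8E8W91.τc + B8E8W91.rτ := by unfold τc rτ; norm_num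

/-- The distance coefficients near the bottom edge are in `[0, θ²]`. [folklore] -/
theorem D_le_bot (k' : ℤ) (h1 : -1 - 1 ≤ k') (h2 : k' ≤ -1 + 1) :
    (0 ≤ (if (frame bd).InWindow k' then
        vmaxB8 k' + χbB8 k' * (frame bd).wt (-1) + χeB8 k' * (frame bd).wt (frame bd).W else (frame bd).wt k')) ∧
    (if (frame bd).InWindow k' then
        vmaxB8 k' + χbB8 k' * (frame bd).wt (-1) + χeB8 k' * (frame bd).wt (frame bd).W else (frame bd).wt k')
      ≤ θw ^ 2 := by
  interval_cases k' <;>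
    norm_num [OneShiftFrame.InWindow, frame, wtB8, vmaxB8, χbB8, χeB8, θw, gHi, ωt, T4W76.toNat_two]

/-- The distance coefficients near the top edge are in `[0, 1.02e-24]`. [folklore] -/
theorem D_le_top (k' : ℤ) (h1 : ((frame bd).W : ℤ) - 1 ≤ k') (h2 : k' ≤ ((frame bd).W : ℤ) + 1) :
    (0 ≤ (if (frame bd).InWindow k' then
        vmaxB8 k' + χbB8 k' * (frame bd).wt (-1) + χeB8 k' * (frame bd).wt (frame bd).W else (frame bd).wt k')) ∧
    (if (frame bd).InWindow k' then
        vmaxB8 k' + χbB8 k' * (frame bd).wt (-1) + χeB8 k' * (frame bd).wt (frame bd).W else (frame bd).wt k')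
      ≤ 102 / 10 ^ 26 := by
  rw [frame_W] at h1 h2
  interval_cases k' <;>
    norm_num [OneShiftFrame.InWindow, frame, wtB8, vmaxB8, χbB8, χeB8, θw, gHi, ωt, T4W76.toNat_two]

/-- [folklore] -/
theorem AB8_le_top' (k' : ℤ) (h1 : ((frame bd).W : ℤ) - 1 ≤ k') (h2 : k' ≤ ((frame bd).W : ℤ) + 1) :
    AB8 k' ≤ abart := by
  rw [frame_W] at h1 h2; exact AB8_le_top k' h1 h2

/-! ### The nine rows of `…_v7s` for this instance (`q = 13/25`) -/

/-- Row `hRBm1` (table-sparse rate at the wake edge). [cite: Tao2016AveragedNS, §4 (4.8); cell vocabulary, harvest/h2-tao-ladder rung1/INSTANCE-SHEET-T4-0.1-W76.md (the B8 instance follows the same sheet)] -/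
theorem row_RBm1 (i : Fin 4) : quadTermLip (2 / 25) αB8 AB8 AB8 i (-1) ≤ 2 * RB8 (-1) := by
  have hε : (0 : ℝ) < 1 + 2 / 25 := by norm_num
  have hΛ1 : 1 ≤ bigLam (2 / 25 : ℝ) := one_le_bigLam (by norm_num)
  have hpos : 0 < bigLam (2 / 25 : ℝ) := bigLam_pos (by norm_num)
  have hS := tableAbsSum_αB8_le i
  have henv := quadTermLip_le_of_bounds hε hΛ1 αB8 (n := -1) (fun k' _ _ => AB8_nonneg k')
    (fun k' _ _ => AB8_nonneg k') AB8_le_bot AB8_le_bot i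
  have hR := RB8_wake 0
  norm_num at hR
  rw [zpow_neg_one] at henv
  rw [hR]
  have hL0 : 0 ≤ (bigLam (2 / 25 : ℝ))⁻¹ := by positivity
  have hTL : tableAbsSum αB8 i * (bigLam (2 / 25))⁻¹ ≤ S * (bigLam (2 / 25))⁻¹ :=
    mul_le_mul_of_nonneg_right hS hL0
  unfold S Q βw gHi at *
  nlinarith [hTL, henv, hL0]

/-- Row `hRBW` (table-sparse rate at the top edge). [cite: Tao2016AveragedNS, §4 (4.8); cell vocabulary, harvest/h2-tao-ladder rung1/INSTANCE-SHEET-T4-0.1-W76.md (the B8 instance follows the same sheet)] -/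
theorem row_RBW (i : Fin 4) :
    quadTermLip (2 / 25) αB8 AB8 AB8 i ((frame bd).W : ℤ) ≤ 2 * RB8 ((frame bd).W : ℤ) := by
  have hε : (0 : ℝ) < 1 + 2 / 25 := by norm_num
  have hΛ1 : 1 ≤ bigLam (2 / 25 : ℝ) := one_le_bigLam (by norm_num)
  have hS := tableAbsSum_αB8_le i
  have henv := quadTermLip_le_of_bounds hε hΛ1 αB8 (n := ((frame bd).W : ℤ)) (fun k' _ _ => AB8_nonneg k')
    (fun k' _ _ => AB8_nonneg k') (AB8_le_top' bd) (AB8_le_top' bd) i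
  have hR := RB8_top 0
  simp only [Nat.cast_zero, add_zero, pow_zero, mul_one] at hR
  have hpos : 0 < bigLam (2 / 25 : ℝ) := bigLam_pos (by norm_num)
  rw [frame_W] at henv ⊢
  rw [zpow_ofNat] at henv
  rw [hR]
  have h0 : 0 ≤ bigLam (2 / 25 : ℝ) ^ (91 : ℕ) * (abart * abart) := by unfold abart; positivity
  have hTS := mul_le_mul_of_nonneg_right hS h0
  unfold S abart at *
  nlinarith [hTS, henv]

/-- Row `hrowB` (contraction row at the wake edge `k = -1`, reading the window bottom). [cite: Tao2016AveragedNS, §4 (4.8), §5.3; cell vocabulary, harvest/h2-tao-ladder rung1/STAGE3-BANACH.md §2] -/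
theorem row_B (i : Fin 4) :
    gHi * (111 / 10 ^ 10 + 182 / 10 ^ 7 * (frame bd).wt (-1) + 1 / 10 ^ 60 * (frame bd).wt (frame bd).W) +
      AB8 0 * (886 / 10 ^ 11 + 248 / 10 ^ 18 * (frame bd).wt (-1) + 1 / 10 ^ 60 * (frame bd).wt (frame bd).W) +
      (frame bd).τhi * quadTermLip (2 / 25) αB8 AB8
        (fun k' => if (frame bd).InWindow k' then
          vmaxB8 k' + χbB8 k' * (frame bd).wt (-1) + χeB8 k' * (frame bd).wt (frame bd).W else (frame bd).wt k')
        i (-1) ≤ 13 / 25 * (frame bd).wt (-1) := by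
  have hε : (0 : ℝ) < 1 + 2 / 25 := by norm_num
  have hΛ1 : 1 ≤ bigLam (2 / 25 : ℝ) := one_le_bigLam (by norm_num)
  have hpos : 0 < bigLam (2 / 25 : ℝ) := bigLam_pos (by norm_num)
  have hS := tableAbsSum_αB8_le i
  have hS0 := tableAbsSum_nonneg i
  have henv := quadTermLip_le_of_bounds hε hΛ1 αB8 (n := -1) (fun k' _ _ => AB8_nonneg k')
    (fun k' h1 h2 => (D_le_bot bd k' h1 h2).1) AB8_le_bot (fun k' h1 h2 => (D_le_bot bd k' h1 h2).2) i
  rw [zpow_neg_one] at henv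
  have hL1 : (bigLam (2 / 25 : ℝ))⁻¹ ≤ 1 := inv_le_one_of_one_le₀ hΛ1
  have hL0 : 0 ≤ (bigLam (2 / 25 : ℝ))⁻¹ := by positivity
  have hTL : tableAbsSum αB8 i * (bigLam (2 / 25))⁻¹ ≤ S * 1 := mul_le_mul hS hL1 hL0 (hS0.trans hS)
  have key := mul_le_mul_of_nonneg_left henv (τhi_nonneg)
  have hA0 : AB8 0 = 57474 / 10 ^ 5 := by norm_num [AB8]
  rw [frame_τhi]
  simp only [frame_wt, frame_W, wtB8_m1, wtB8_91, hA0] at key ⊢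
  unfold S Q βw θw gHi ωt τc rτ at *
  nlinarith [key, hTL]

/-- Row `hrowT` (contraction row at the top edge `k = W`, reading the window top). [cite: Tao2016AveragedNS, §4 (4.8), §5.3; cell vocabulary, harvest/h2-tao-ladder rung1/STAGE3-BANACH.md §2] -/
theorem row_T (i : Fin 4) :
    gHi * ((frame bd).wt (((frame bd).W : ℤ) + 1) + RB8 (((frame bd).W : ℤ) + 1) * (frame bd).rτ) +
      AB8 (((frame bd).W : ℤ) + 1) *
        (886 / 10 ^ 11 + 248 / 10 ^ 18 * (frame bd).wt (-1) + 1 / 10 ^ 60 * (frame bd).wt (frame bd).W) +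
      (frame bd).τhi * quadTermLip (2 / 25) αB8 AB8
        (fun k' => if (frame bd).InWindow k' then
          vmaxB8 k' + χbB8 k' * (frame bd).wt (-1) + χeB8 k' * (frame bd).wt (frame bd).W else (frame bd).wt k')
        i (frame bd).W ≤ 13 / 25 * (frame bd).wt (frame bd).W := by
  have hε : (0 : ℝ) < 1 + 2 / 25 := by norm_num
  have hΛ1 : 1 ≤ bigLam (2 / 25 : ℝ) := one_le_bigLam (by norm_num)
  have hpos : 0 < bigLam (2 / 25 : ℝ) := bigLam_pos (by norm_num)
  obtain ⟨-, hΛhi⟩ := bigLam_e8_bounds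
  have hS := tableAbsSum_αB8_le i
  have hS0 := tableAbsSum_nonneg i
  have henv := quadTermLip_le_of_bounds hε hΛ1 αB8 (n := ((frame bd).W : ℤ)) (fun k' _ _ => AB8_nonneg k')
    (fun k' h1 h2 => (D_le_top bd k' h1 h2).1) (AB8_le_top' bd) (fun k' h1 h2 => (D_le_top bd k' h1 h2).2) i
  have key := mul_le_mul_of_nonneg_left henv (τhi_nonneg)
  have hw92 : wtB8 (91 + 1) = ωt * (1 / 2) ^ 1 := by exact_mod_cast wtB8_top 1
  have hA92 : AB8 (91 + 1) = εR * (1 / 2) ^ 1 := by exact_mod_cast AB8_top 1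
  have hR92 : RB8 (91 + 1) = (S * abart ^ 2 * bigLam (2 / 25) ^ (91 : ℕ)) * (bigLam (2 / 25) * (1 / 2) ^ 2) ^ 1 := by
    exact_mod_cast RB8_top 1
  rw [frame_τhi, frame_rτ]
  simp only [frame_wt, frame_W, wtB8_m1, wtB8_91, hw92, hA92, hR92, pow_one, zpow_ofNat] at key ⊢
  -- `W = 91` is odd: `Λ₀^91 = Λ₀^90 · Λ₀` with `Λ₀^90` rational and `Λ₀ ≤ 1.2122`, `Λ₀² = 1.08⁵`
  rw [show bigLam (2 / 25 : ℝ) ^ 91 = bigLam (2 / 25) ^ 90 * bigLam (2 / 25) from pow_succ _ 90,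
    bigLam_e8_pow_90] at key ⊢
  have h2 : bigLam (2 / 25 : ℝ) ^ 2 = 14693280768 / 10000000000 := by rw [bigLam_sq (by norm_num)]; norm_num
  have hTΛ : tableAbsSum αB8 i * bigLam (2 / 25) ≤ S * (12122 / 10000) :=
    mul_le_mul hS hΛhi hpos.le (hS0.trans hS)
  unfold S abart θw gHi ωt εR τc rτ at *
  nlinarith [key, hTΛ, h2, hΛhi]

/-- Row `hfirstW` (first interior wake contraction row `k = -2`). [cite: Tao2016AveragedNS, §4 (4.8); cell vocabulary, harvest/h2-tao-ladder rung1/STAGE3-BANACH.md §2 (θ_w)] -/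
theorem row_firstW (i : Fin 4) :
    gHi * (1 * θw + (S * Q ^ 2 * βw ^ 2) * (βw ^ 2 * (bigLam (2 / 25))⁻¹) * (frame bd).rτ) +
      Q * βw * (886 / 10 ^ 11 + 248 / 10 ^ 18 * (frame bd).wt (-1) + 1 / 10 ^ 60 * (frame bd).wt (frame bd).W) +
      (frame bd).τhi * (2 * tableAbsSum αB8 i * (bigLam (2 / 25))⁻¹ ^ 2 * (1 * θw ^ 3) * (Q * βw ^ 3)) ≤
      13 / 25 * (1 * θw ^ 2) := by
  have hΛ1 : 1 ≤ bigLam (2 / 25 : ℝ) := one_le_bigLam (by norm_num)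
  have hpos : 0 < bigLam (2 / 25 : ℝ) := bigLam_pos (by norm_num)
  have hS := tableAbsSum_αB8_le i
  have hS0 := tableAbsSum_nonneg i
  have hL1 : (bigLam (2 / 25 : ℝ))⁻¹ ≤ 1 := inv_le_one_of_one_le₀ hΛ1
  have hL0 : 0 ≤ (bigLam (2 / 25 : ℝ))⁻¹ := by positivity
  have hTL2 : tableAbsSum αB8 i * (bigLam (2 / 25))⁻¹ ^ 2 ≤ S * 1 :=
    mul_le_mul hS (by nlinarith) (by positivity) (hS0.trans hS)
  rw [frame_τhi, frame_rτ]
  simp only [frame_wt, frame_W, wtB8_m1, wtB8_91]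
  unfold S Q βw θw gHi ωt τc rτ at *
  nlinarith [hTL2, hL1, hL0]

/-- Row `hfirstWS` (wake self-map row). [cite: Tao2016AveragedNS, §4 (4.8); cell vocabulary, harvest/h2-tao-ladder rung1/STAGE2-LEMMA.md §5 (Lemma 4a)] -/
theorem row_firstWS :
    cmax * max (gHi - ghat) (ghat - gLo) * ghat +
      (frame bd).τhi * ((S * Q ^ 2 * βw ^ 2) * (βw ^ 2 * (bigLam (2 / 25))⁻¹) ^ 2) ≤ κw * gHi ^ 2 := by
  have hΛ1 : 1 ≤ bigLam (2 / 25 : ℝ) := one_le_bigLam (by norm_num)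
  have hpos : 0 < bigLam (2 / 25 : ℝ) := bigLam_pos (by norm_num)
  have hL1 : (bigLam (2 / 25 : ℝ))⁻¹ ≤ 1 := inv_le_one_of_one_le₀ hΛ1
  have hL0 : 0 ≤ (bigLam (2 / 25 : ℝ))⁻¹ := by positivity
  have hL2 : (bigLam (2 / 25 : ℝ))⁻¹ ^ 2 ≤ 1 := pow_le_one₀ hL0 hL1
  have hmax : max (gHi - ghat) (ghat - gLo) = 89 / 10 ^ 10 := by norm_num [gHi, ghat, gLo]
  rw [hmax, frame_τhi]
  unfold cmax ghat S Q βw gHi κw τc rτ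
  nlinarith [hL2]

/-- Row `hfirstT` (first interior top contraction row `k = W+1`). [cite: Tao2016AveragedNS, §4 (4.8); cell vocabulary, harvest/h2-tao-ladder rung1/STAGE3-BANACH.md §2 (θ_t)] -/
theorem row_firstT (i : Fin 4) :
    gHi * (ωt * (1 / 2) ^ 2 +
        (S * abart ^ 2 * bigLam (2 / 25) ^ (frame bd).W) * (bigLam (2 / 25) * (1 / 2) ^ 2) ^ 2 * (frame bd).rτ) +
      (abart * (1 / 2)) * (1 / 2) ^ 2 *
        (886 / 10 ^ 11 + 248 / 10 ^ 18 * (frame bd).wt (-1) + 1 / 10 ^ 60 * (frame bd).wt (frame bd).W) +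
      (frame bd).τhi * (2 * tableAbsSum αB8 i * bigLam (2 / 25) ^ ((frame bd).W + 1) * ωt * (abart * (1 / 2))) ≤
      13 / 25 * (ωt * (1 / 2)) := by
  have hpos : 0 < bigLam (2 / 25 : ℝ) := bigLam_pos (by norm_num)
  obtain ⟨-, hΛhi⟩ := bigLam_e8_bounds
  have h2 : bigLam (2 / 25 : ℝ) ^ 2 = 14693280768 / 10000000000 := by rw [bigLam_sq (by norm_num)]; norm_num
  have hS := tableAbsSum_αB8_le i
  have hS0 := tableAbsSum_nonneg i
  have hTΛ : tableAbsSum αB8 i * bigLam (2 / 25) ≤ S * (12122 / 10000) := mul_le_mul hS hΛhi hpos.le (hS0.trans hS)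
  -- `W = 91` is odd: `Λ₀^92 = (Λ₀²)^46` is rational, `Λ₀^91 = Λ₀^90 · Λ₀`, `Λ₀³ = Λ₀² · Λ₀`
  have h92 : bigLam (2 / 25 : ℝ) ^ ((frame bd).W + 1) = (14693280768 / 10000000000) ^ 46 := by
    rw [frame_W', show (91 + 1 : ℕ) = 2 * 46 by norm_num, pow_mul, h2]
  have h91 : bigLam (2 / 25 : ℝ) ^ (frame bd).W = (14693280768 / 10000000000) ^ 45 * bigLam (2 / 25) := by
    rw [frame_W', pow_succ, bigLam_e8_pow_90]
  have h3 : bigLam (2 / 25 : ℝ) ^ 3 = 14693280768 / 10000000000 * bigLam (2 / 25) := by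
    rw [pow_succ, h2]
  rw [h92, h91, frame_τhi, frame_rτ]
  simp only [frame_wt, frame_W, wtB8_m1, wtB8_91]
  unfold S abart θw gHi ωt τc rτ at *
  nlinarith [hTΛ, h2, h3, hΛhi]

/-- Row `hfirstTS` (top self-map row). [cite: Tao2016AveragedNS, §4 (4.8); cell vocabulary, harvest/h2-tao-ladder rung1/STAGE2-LEMMA.md §5 (Lemma 4b)] -/
theorem row_firstTS :
    gHi * (εR * (1 / 2)) + (frame bd).τhi * (S * abart ^ 2 * bigLam (2 / 25) ^ (frame bd).W) ≤ εR := by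
  obtain ⟨-, hΛhi⟩ := bigLam_e8_bounds
  rw [frame_τhi, frame_W', show bigLam (2 / 25 : ℝ) ^ 91 = bigLam (2 / 25) ^ 90 * bigLam (2 / 25) from pow_succ _ 90,
    bigLam_e8_pow_90]
  unfold gHi εR S abart τc rτ
  nlinarith [hΛhi]

/-- Row `hrow1` (wake entry row). [cite: Tao2016AveragedNS, §5.3; cell vocabulary, harvest/h2-tao-ladder rung1/STAGE2-LEMMA.md §5] -/
theorem row_1 : 302 / 10 ^ 8 + (frame bd).τhi * RB8 (-1) ≤ (frame bd).tubeR (-1) := by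
  have hΛ1 : 1 ≤ bigLam (2 / 25 : ℝ) := one_le_bigLam (by norm_num)
  have hpos : 0 < bigLam (2 / 25 : ℝ) := bigLam_pos (by norm_num)
  have hL1 : (bigLam (2 / 25 : ℝ))⁻¹ ≤ 1 := inv_le_one_of_one_le₀ hΛ1
  have hR := RB8_wake 0
  norm_num at hR
  have ht : tubeRB8 (-1) = gHi * (r₀ + κw) := by norm_num [tubeRB8]
  rw [frame_τhi, frame_tubeR, hR, ht]
  unfold S Q βw gHi r₀ κw τc rτ
  nlinarith [hL1]

/-- Window row `hqX`. [cite: Tao2016AveragedNS, §5.3; cell vocabulary, harvest/h2-tao-ladder rung1/STAGE3-BANACH.md §2 (row 1 of L̃)] -/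
theorem row_qX :
    394 / 10 ^ 5 + 107 / 10 ^ 7 * (frame bd).wt (-1) + 13396 * 10 ^ 20 * (frame bd).wt (frame bd).W ≤ 13 / 25 := by
  simp only [frame_wt, frame_W, wtB8_m1, wtB8_91]
  unfold θw gHi ωt; norm_num

end B8E8W91

end DSSOneShift

end Summit.NavierStokesRegularity.NavierStokesRegularity.Theorems
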